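import Literature.Geometry.Lorentzian.KerrBoyerLindquistExtrinsicForm
import Literature.Geometry.Lorentzian.SecondFundamentalFormLocality
import Literature.Geometry.Lorentzian.KerrRicciFlat
import Literature.Geometry.Lorentzian.ChartSecondFundamentalForm
import Literature.Geometry.Lorentzian.HypersurfaceNaturality
import HarnessLib

/-!
# The Boyer–Lindquist slice of Kerr as a map from quasi-isotropic Cartesian coordinates, VII:
# the second fundamental form of the leaf

Continuing `KerrBoyerLindquistExtrinsicForm.lean`: **the second fundamental form of the
Boyer–Lindquist leaf `Kerr.BL.leaf M a b ρ₁` with respect to its future unit normal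
`Kerr.BL.normal` is the closed form `kRepCLM`** at every point of the slice, axis included
(`secondFundamentalForm_leaf`). Proof:

* off the axis the leaf factors locally through the ingoing Kerr chart `Ψ`,
  `leaf = Ψ ∘ σ_x` near `x` (`chartFun_coordSection_eventuallyEq`), and `normal = dΨ(n ∘ σ_x)`
  (`normalRep_eq_jac`); on the pulled-back metric `Ψ^*g` of the coordinate domain (`coordMetric`,
  components `Kerr.Ingoing.bilin`) the coordinate formula
  (`OpensChart.secondFundamentalForm_eq_of_repr`) and the identities of `…SliceExtrinsic.lean` /
  `…ExtrinsicForm.lean` give `K^{Ψ^*g}_{σ_x, n∘σ_x}(x) = k_x`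
  (`secondFundamentalForm_coordMetric_secMap`); naturality of the second fundamental form under
  the local isometry `Ψ` (`secondFundamentalForm_comap`) and its locality in the pair (map, normal
  field) (`secondFundamentalForm_congr_of_eventuallyEq`) transfer this to `K^g_{leaf, normal}(x)`
  (`secondFundamentalForm_leaf_offAxis`);
* on the axis both sides are continuous in the base point — the left side by the coordinate
  formula in the Kerr–Schild chart — and agree off the axis (`Kerr.eqOn_slice_of_offAxis`).

This is the last geometric clause of an exact Kerr end (`InitialDataSet.IsExactKerrEndAlong`,
`k = K_ν(ψ)`) for the rest-frame Boyer–Lindquist leaf of Kerr with arbitrary spin.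

References: Brandt–Seidel, Phys. Rev. D 52 (1995) 856, (9), and 54 (1996) 1403, §II; O'Neill 1983,
Ch. 3, Prop. 3.59 and Ch. 4, Lemma 4.4; Wald 1984, (10.2.13).
-/

noncomputable section

-- instance search through the nested operator types `E4 →L[ℝ] E4 →L[ℝ] ℝ`
set_option maxSynthPendingDepth 3

open Bundle TopologicalSpace Set Module Real Filter Function
open scoped InnerProductSpace Topology ContDiff Manifold

namespace Literature.Geometry.Lorentzian

namespace Kerr.BL

open Kerr.Ingoing

variable {M a b ρ₁ : ℝ}

/-! ### The pulled-back metric on the ingoing coordinate domain -/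

section CoordMetric

variable [Kerr.Facts] (M a : ℝ)

/-- **The pulled-back Kerr metric `Ψ^* g` on the ingoing coordinate domain** `{r > 0, −1 < μ < 1}`
(chart floor `r₀ = 0`), along the immersion `Ψ ∘ Subtype.val`. O'Neill 1983, Ch. 3, Def. 3.9.
[cite: ONeill1983, Ch. 3, Def. 3.9 and p. 58] -/
abbrev coordMetric :
    PseudoRiemannianMetric 𝓘(ℝ, E4) ∞ E4 (TangentSpace 𝓘(ℝ, E4) : Ingoing.coordDomain (0 : ℝ) → Type _) :=
  (Kerr.smoothMetric M a 0).toPseudoRiemannianMetric.comap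
    PseudoRiemannianMetric.contMDiff_pullbackBilin_holds
    (Ingoing.chart a 0 ∘ (Subtype.val : Ingoing.coordDomain (0 : ℝ) → E4))
    (contMDiff_immersedChart_comp_val Ingoing.contMDiffOn_chart)
    (injective_mfderiv_immersedChart_comp_val Ingoing.contMDiffOn_chart
      Ingoing.injective_mfderiv_chart) rfl

/-- The pulled-back metric carries its Levi-Civita connection. [cite: ONeill1983, Ch. 3, Thm. 3.11] -/
instance coordMetric_hasLeviCivita : (coordMetric M a).HasLeviCivita :=
  (coordMetric M a).hasLeviCivita

/-- **The components of `Ψ^* g` are the rational Kerr components** `Kerr.Ingoing.bilin`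
(`Kerr.Ingoing.kerrBilin_jac`). Kerr 1963, (1); Visser arXiv:0706.0622, (E:K1).
[cite: arXiv07060622, (E:K1)–(E:K2)] -/
theorem coordMetric_val (z : Ingoing.coordDomain (0 : ℝ)) :
    (coordMetric M a).val z = Ingoing.bilin M a z := by
  rw [val_comap_immersedChart (Kerr.smoothMetric M a 0).toPseudoRiemannianMetric
    Ingoing.contMDiffOn_chart Ingoing.injective_mfderiv_chart rfl z]
  ext v w
  rw [pullbackBilin_apply, Ingoing.mfderiv_chart z.2]
  exact Ingoing.kerrBilin_jac z.2 v w

end CoordMetric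

/-! ### The clamped coordinate section about an off-axis base point -/

open Classical in
variable (M a b) in
/-- The coordinate section `σ_x` clamped into the coordinate domain (junk value `σ_x(x)` where
`σ_x(y)` leaves the domain; it agrees with `σ_x` near `x`, `secFun_eventuallyEq`). [folklore] -/
def secFun (x y : E3) : E4 :=
  if coordSection M a b x y ∈ (Ingoing.coordDomain (0 : ℝ) : Set E4) then coordSection M a b x y
  else coordSection M a b x x

/-- Where `σ_x(y)` lies in the coordinate domain the clamped section is `σ_x(y)`. [folklore] -/
theorem secFun_of_mem {x y : E3} (h : coordSection M a b x y ∈ Ingoing.coordDomain (0 : ℝ)) :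
    secFun M a b x y = coordSection M a b x y := by
  unfold secFun
  exact if_pos h

/-- The clamped section takes values in the coordinate domain. [folklore] -/
theorem secFun_mem {x : E3} (hx0 : coordSection M a b x x ∈ Ingoing.coordDomain (0 : ℝ)) (y : E3) :
    secFun M a b x y ∈ Ingoing.coordDomain (0 : ℝ) := by
  unfold secFun
  split_ifs with h
  · exact h
  · exact hx0

/-- Near an off-axis base point beyond the threshold the clamped section is the honest one.
[folklore] -/
theorem secFun_eventuallyEq (hb : rH M a < b) {x : E3} (hρ : rhoH M a < ‖x‖)
    (hx : x 0 ≠ 0 ∨ x 1 ≠ 0) (hR : max 0 0 < qiRadius M a ‖x‖) :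
    secFun M a b x =ᶠ[𝓝 x] coordSection M a b x := by
  have hc : ContinuousAt (coordSection M a b x) x := (hasFDerivAt_coordSection hb hρ hx).continuousAt
  have hmem : coordSection M a b x x ∈ Ingoing.coordDomain (0 : ℝ) := coordSection_mem_coordDomain hx hR
  have hev : ∀ᶠ y in 𝓝 x, coordSection M a b x y ∈ (Ingoing.coordDomain (0 : ℝ) : Set E4) :=
    hc.preimage_mem_nhds ((Ingoing.coordDomain (0 : ℝ)).isOpen.mem_nhds hmem)
  filter_upwards [hev] with y hy
  exact secFun_of_mem hy

variable (M a b) in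
/-- The clamped section as a map of the slice into the coordinate domain. [folklore] -/
def secMap (ρ₁ : ℝ) {x : E3} (hx0 : coordSection M a b x x ∈ Ingoing.coordDomain (0 : ℝ)) :
    slice 0 ρ₁ → Ingoing.coordDomain (0 : ℝ) :=
  fun y ↦ ⟨secFun M a b x y, secFun_mem hx0 y⟩

/-- **Off the axis the normal is the push-forward of the coordinate normal along `σ_x`** at every
nearby point `y` (two-point version of `normalRep_eq`). [cite: BrandtSeidel1996, §II] -/
theorem normalRep_eq_jac {r₀ : ℝ} {x y : E3} (hx : x 0 ≠ 0 ∨ x 1 ≠ 0) (hy : y 0 ≠ 0 ∨ y 1 ≠ 0)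
    (hR : max r₀ 0 < qiRadius M a ‖y‖) :
    normalRep M a b y = jac a (coordSection M a b x y) (blNormal M a (coordSection M a b x y)) := by
  have hmem : coordSection M a b x y ∈ coordDomain r₀ := coordSection_mem_coordDomain hy hR
  have hks : kerrStar a (coordSection M a b x y 1) (arccos (coordSection M a b x y 2))
      (coordSection M a b x y 3) = leafSpatial M a b y := by
    have h := congrArg E4.spatial
      (chartFun_coordSection (M := M) (a := a) (b := b) (r₀ := r₀) hx hy hR)
    rwa [chartFun_eq hmem, E4.spatial_ofTimeSpace, spatial_leafRep] at h
  have h1 : coordSection M a b x y 1 = qiRadius M a ‖y‖ := rfl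
  have h2 : coordSection M a b x y 2 = y 2 / ‖y‖ := rfl
  have hl : lapseE M a y = blLapse M a (coordSection M a b x y) := (blLapse_eq_lapseE h1 h2).symm
  have ho : omegaE M a y = blOmega M a (coordSection M a b x y) := (blOmega_eq_omegaE h1 h2).symm
  have o1 : ∀ (t : ℝ) (p : E3), E4.ofTimeSpace t p 1 = p 0 := fun _ _ ↦ rfl
  have o2 : ∀ (t : ℝ) (p : E3), E4.ofTimeSpace t p 2 = p 1 := fun _ _ ↦ rfl
  have o3 : ∀ (t : ℝ) (p : E3), E4.ofTimeSpace t p 3 = p 2 := fun _ _ ↦ rfl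
  have e0 : leafSpatial M a b y 0 = jacP a (coordSection M a b x y) 1 := by
    rw [jacP_apply_one, hks]
  have e1 : leafSpatial M a b y 1 = -jacP a (coordSection M a b x y) 0 := by
    rw [jacP_apply_zero, hks, neg_neg]
  ext i
  fin_cases i
  · simp [normalRep, jac_apply, blNormal, blNormal0, hl]
  · show normalRep M a b y 1 = jac a (coordSection M a b x y) (blNormal M a (coordSection M a b x y)) 1
    simp [normalRep, jac_apply, blNormal, blNormal0, hl, ho, leafRep, o1, o2, e1]
  · show normalRep M a b y 2 = jac a (coordSection M a b x y) (blNormal M a (coordSection M a b x y)) 2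
    simp [normalRep, jac_apply, blNormal, blNormal0, hl, ho, leafRep, o1, o2, e0]
  · show normalRep M a b y 3 = jac a (coordSection M a b x y) (blNormal M a (coordSection M a b x y)) 3
    simp [normalRep, jac_apply, blNormal, blNormal0, o3, jacP_apply_two]

/-! ### The second fundamental form on the coordinate side -/

/-- **`K^{Ψ^*g}_{σ_x, n ∘ σ_x}(x) = k_x`**: on the pulled-back metric the coordinate formula
`K(v, w) = (Ψ^*g)(D(n∘σ)v + Γ(n)(dσ v), dσ w)` collapses, through
`bilin_fderiv_blNormal_add_koszul`, `blK0_blLift_blLift` and `lapse_inv_mul_blK0_eq_kRepCLM`, to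
the closed form (`0 ≤ M`, `ρ₁ ≥ ρH`, `b > rH`, `x` off the axis). O'Neill 1983, Ch. 4, Lemma 4.4;
Brandt–Seidel 1995, (9). [cite: BrandtSeidel1996, §II] -/
theorem secondFundamentalForm_coordMetric_secMap [Kerr.Facts] (hM : 0 ≤ M) (hρ₁ : rhoH M a ≤ ρ₁)
    (hb : rH M a < b) (x : slice 0 ρ₁) (hx : (x : E3) 0 ≠ 0 ∨ (x : E3) 1 ≠ 0)
    (hx0 : coordSection M a b x x ∈ Ingoing.coordDomain (0 : ℝ)) (v w : E3) :
    (coordMetric M a).secondFundamentalForm 𝓘(ℝ, E3) (secMap M a b ρ₁ hx0)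
      (fun y ↦ blNormal M a (secFun M a b x y)) x v w = kRepCLM M a x v w := by
  set u : E4 := coordSection M a b x x with hu
  have hρ : rhoH M a < ‖(x : E3)‖ := rhoH_lt_norm hρ₁ x
  have hR : max 0 0 < qiRadius M a ‖(x : E3)‖ := max_lt_qiRadius hM hρ₁ x
  obtain ⟨hΔ, hS, hA⟩ := coordSection_pos (b := b) hM hρ hx hR
  have hs : sinSq u ≠ 0 := sinSq_ne_zero hx0
  have hpt : secFun M a b x x = u := secFun_of_mem hx0
  have hΦ : HasFDerivAt (secFun M a b x) (coordSectionDeriv M a x) x :=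
    (hasFDerivAt_coordSection hb hρ hx).congr_of_eventuallyEq (secFun_eventuallyEq hb hρ hx hR)
  have hg : HasFDerivAt (blNormal M a) (fderiv ℝ (blNormal M a) u) (secFun M a b x x) := by
    rw [hpt]
    exact (hasFDerivAt_blNormal hΔ hS hA).differentiableAt.hasFDerivAt
  have hN : HasFDerivAt (fun y ↦ blNormal M a (secFun M a b x y))
      ((fderiv ℝ (blNormal M a) u).comp (coordSectionDeriv M a x)) x := hg.comp (x : E3) hΦ
  have hGd : DifferentiableAt ℝ (Ingoing.bilin M a) (secMap M a b ρ₁ hx0 x : E4) := by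
    show DifferentiableAt ℝ (Ingoing.bilin M a) (secFun M a b x x)
    rw [hpt]
    exact (hasFDerivAt_bilin M a hS.ne' hs).differentiableAt
  rw [OpensChart.secondFundamentalForm_eq_of_repr (g := coordMetric M a) (G := Ingoing.bilin M a)
    (coordMetric_val M a) (f := secMap M a b ρ₁ hx0) (Φ := secFun M a b x) (fun _ ↦ rfl)
    (ν := fun y ↦ blNormal M a (secFun M a b x y)) (N := fun y ↦ blNormal M a (secFun M a b x y))
    (fun _ ↦ rfl) hΦ.differentiableAt hN.differentiableAt hGd v w]
  have hcoe : ((secMap M a b ρ₁ hx0 x : Ingoing.coordDomain (0 : ℝ)) : E4) = u := hpt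
  have hΓ' : Ingoing.bilin M a u (OpensChart.christoffel (coordMetric M a) (Ingoing.bilin M a)
      (secMap M a b ρ₁ hx0 x) (blNormal M a (secFun M a b x x)) (fderiv ℝ (secFun M a b x) x v))
      (fderiv ℝ (secFun M a b x) x w) =
      2⁻¹ * OpensChart.koszulForm (Ingoing.bilin M a) u (blNormal M a (secFun M a b x x))
        (fderiv ℝ (secFun M a b x) x v) (fderiv ℝ (secFun M a b x) x w) := by
    have h := OpensChart.val_christoffel_const (g := coordMetric M a) (G := Ingoing.bilin M a)
      (secMap M a b ρ₁ hx0 x) (blNormal M a (secFun M a b x x)) (fderiv ℝ (secFun M a b x) x v)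
      (fderiv ℝ (secFun M a b x) x w)
    rw [coordMetric_val M a, hcoe] at h
    exact h
  rw [coordMetric_val M a, hcoe]
  show Ingoing.bilin M a u (fderiv ℝ (fun y ↦ blNormal M a (secFun M a b x y)) x v +
      OpensChart.christoffel (coordMetric M a) (Ingoing.bilin M a) (secMap M a b ρ₁ hx0 x)
        (blNormal M a (secFun M a b x x)) (fderiv ℝ (secFun M a b x) x v))
      (fderiv ℝ (secFun M a b x) x w) = kRepCLM M a x v w
  rw [map_add, add_apply, hΓ', hN.fderiv, hΦ.fderiv]
  simp only [ContinuousLinearMap.comp_apply, hpt]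
  have hw : coordSectionDeriv M a (x : E3) w =
      blLift M a (u 1) (qiRoot M a ‖(x : E3)‖ / ‖(x : E3)‖ * (⟪(x : E3), w⟫_ℝ / ‖(x : E3)‖))
        (dMu x w) (dPhi x w) := coordSectionDeriv_apply hx w
  rw [hw, bilin_fderiv_blNormal_add_koszul hΔ hS hA hs, ← hw]
  exact lapse_inv_mul_blK0_eq_kRepCLM hM hρ hx hR v w

/-! ### Transfer to the leaf: naturality and locality -/

/-- **Off the axis, `K^g_{leaf, normal}(x) = k_x`** (naturality of the second fundamental form
under the local isometry `Ψ`, `secondFundamentalForm_comap`, and locality in the pair (map, normal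
field), `secondFundamentalForm_congr_of_eventuallyEq`: near `x`, `leaf = Ψ ∘ σ_x` and
`normal = dΨ(n ∘ σ_x)`). O'Neill 1983, Ch. 3, Prop. 3.59 and Ch. 4, Lemma 4.4.
[cite: ONeill1983, Ch. 3, Prop. 3.59 and Ch. 4, Lemma 4.4] -/
theorem secondFundamentalForm_leaf_offAxis [Kerr.Facts] [(Kerr.smoothMetric M a 0).HasLeviCivita]
    (hM : 0 ≤ M) (hρ₁ : rhoH M a ≤ ρ₁) (hb : rH M a < b) (x : slice 0 ρ₁)
    (hx : (x : E3) 0 ≠ 0 ∨ (x : E3) 1 ≠ 0) (v w : E3) :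
    (Kerr.smoothMetric M a 0).secondFundamentalForm 𝓘(ℝ, E3) (leaf M a b ρ₁ hM hρ₁)
      (normal M a b ρ₁ hM hρ₁) x v w = kRepCLM M a x v w := by
  set g := (Kerr.smoothMetric M a 0).toPseudoRiemannianMetric with hg
  have hρ : rhoH M a < ‖(x : E3)‖ := rhoH_lt_norm hρ₁ x
  have hR : max 0 0 < qiRadius M a ‖(x : E3)‖ := max_lt_qiRadius hM hρ₁ x
  have hx0 : coordSection M a b x x ∈ Ingoing.coordDomain (0 : ℝ) := coordSection_mem_coordDomain hx hR
  obtain ⟨hΔ, hS, hA⟩ := coordSection_pos (b := b) hM hρ hx hR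
  have hpt : secFun M a b x x = coordSection M a b x x := secFun_of_mem hx0
  -- differentiability of the section and of the normal along it at `x`
  have hΦ : HasFDerivAt (secFun M a b x) (coordSectionDeriv M a x) x :=
    (hasFDerivAt_coordSection hb hρ hx).congr_of_eventuallyEq (secFun_eventuallyEq hb hρ hx hR)
  have hgN : HasFDerivAt (blNormal M a) (fderiv ℝ (blNormal M a) (coordSection M a b x x))
      (secFun M a b x x) := by
    rw [hpt]
    exact (hasFDerivAt_blNormal hΔ hS hA).differentiableAt.hasFDerivAt
  have hN : DifferentiableAt ℝ (fun y ↦ blNormal M a (secFun M a b x y)) x :=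
    (hgN.comp (x : E3) hΦ).differentiableAt
  have hlift : MDifferentiableAt 𝓘(ℝ, E3) 𝓘(ℝ, E4).tangent
      (fun y ↦ (TotalSpace.mk' E4 (secMap M a b ρ₁ hx0 y) (blNormal M a (secFun M a b x y)) :
        TangentBundle 𝓘(ℝ, E4) (Ingoing.coordDomain (0 : ℝ)))) x :=
    OpensChart.mdifferentiableAt_lift_of_repr (f := secMap M a b ρ₁ hx0) (Φ := secFun M a b x)
      (fun _ ↦ rfl) (ν := fun y ↦ blNormal M a (secFun M a b x y))
      (N := fun y ↦ blNormal M a (secFun M a b x y)) (fun _ ↦ rfl) hΦ.differentiableAt hN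
  -- naturality under the local isometry `Ψ`
  have hcomap := g.secondFundamentalForm_comap PseudoRiemannianMetric.contMDiff_pullbackBilin_holds
    (contMDiff_immersedChart_comp_val Ingoing.contMDiffOn_chart)
    (injective_mfderiv_immersedChart_comp_val Ingoing.contMDiffOn_chart
      Ingoing.injective_mfderiv_chart) rfl
    (f := secMap M a b ρ₁ hx0) (ν := fun y ↦ blNormal M a (secFun M a b x y)) (y := x)
    BoundarylessManifold.isInteriorPoint hlift
  -- locality in the pair (map, normal field): near `x` the lifts agree with `(leaf, normal)`
  have key : ∀ (p q : region a 0), p = q → ∀ (V W : E4), V = W →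
      (TotalSpace.mk' E4 p V : TangentBundle 𝓘(ℝ, E4) (region a 0)) = TotalSpace.mk' E4 q W := by
    intro p q hpq V W hVW
    subst hpq
    subst hVW
    rfl
  have ho : IsOpen {z : E3 | z 0 ≠ 0 ∨ z 1 ≠ 0} :=
    (isOpen_ne_fun (EuclideanSpace.proj (𝕜 := ℝ) (0 : Fin 3)).continuous continuous_const).union
      (isOpen_ne_fun (EuclideanSpace.proj (𝕜 := ℝ) (1 : Fin 3)).continuous continuous_const)
  have hev : ∀ᶠ z : slice 0 ρ₁ in 𝓝 x, (z : E3) 0 ≠ 0 ∨ (z : E3) 1 ≠ 0 :=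
    (ho.preimage continuous_subtype_val).mem_nhds hx
  have hlifts : (fun z : slice 0 ρ₁ ↦ (TotalSpace.mk' E4
        (((Ingoing.chart a 0 ∘ (Subtype.val : Ingoing.coordDomain (0 : ℝ) → E4)) ∘
          secMap M a b ρ₁ hx0) z)
        (mfderiv 𝓘(ℝ, E4) 𝓘(ℝ, E4)
          (Ingoing.chart a 0 ∘ (Subtype.val : Ingoing.coordDomain (0 : ℝ) → E4))
          (secMap M a b ρ₁ hx0 z) (blNormal M a (secFun M a b x z))) :
        TangentBundle 𝓘(ℝ, E4) (region a 0))) =ᶠ[𝓝 x]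
      fun z ↦ TotalSpace.mk' E4 (leaf M a b ρ₁ hM hρ₁ z) (normal M a b ρ₁ hM hρ₁ z) := by
    filter_upwards [hev] with z hz
    have hRz : max 0 0 < qiRadius M a ‖(z : E3)‖ := max_lt_qiRadius hM hρ₁ z
    have hmemz : coordSection M a b x z ∈ Ingoing.coordDomain (0 : ℝ) :=
      coordSection_mem_coordDomain hz hRz
    have hsec : secFun M a b x z = coordSection M a b x z := secFun_of_mem hmemz
    have hbase : ((Ingoing.chart a 0 ∘ (Subtype.val : Ingoing.coordDomain (0 : ℝ) → E4)) ∘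
        secMap M a b ρ₁ hx0) z = leaf M a b ρ₁ hM hρ₁ z := by
      apply Subtype.ext
      show chartFun a 0 (secFun M a b x z) = leafRep M a b z
      rw [hsec]
      exact chartFun_coordSection hx hz hRz
    have hvec : mfderiv 𝓘(ℝ, E4) 𝓘(ℝ, E4)
        (Ingoing.chart a 0 ∘ (Subtype.val : Ingoing.coordDomain (0 : ℝ) → E4))
        (secMap M a b ρ₁ hx0 z) (blNormal M a (secFun M a b x z)) = normalRep M a b z := by
      rw [mfderiv_immersedChart_comp_val_apply Ingoing.contMDiffOn_chart (secMap M a b ρ₁ hx0 z)]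
      show mfderiv 𝓘(ℝ, E4) 𝓘(ℝ, E4) (Ingoing.chart a 0) (secFun M a b x z)
        (blNormal M a (secFun M a b x z)) = normalRep M a b z
      rw [hsec, Ingoing.mfderiv_chart hmemz]
      exact (normalRep_eq_jac hx hz hRz).symm
    exact key _ _ hbase _ _ hvec
  have hloc := g.secondFundamentalForm_congr_of_eventuallyEq (I' := 𝓘(ℝ, E3))
    (BoundarylessManifold.isInteriorPoint (I := 𝓘(ℝ, E3)) (x := x)) hlifts
  -- assemble
  have h1 : g.secondFundamentalForm 𝓘(ℝ, E3) (leaf M a b ρ₁ hM hρ₁) (normal M a b ρ₁ hM hρ₁) x v w =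
      (coordMetric M a).secondFundamentalForm 𝓘(ℝ, E3) (secMap M a b ρ₁ hx0)
        (fun y ↦ blNormal M a (secFun M a b x y)) x v w := by
    rw [← hloc, ← hcomap]
  exact h1.trans (secondFundamentalForm_coordMetric_secMap hM hρ₁ hb x hx hx0 v w)

/-! ### Continuity across the axis -/

/-- **The chart expression of `K^g_{leaf, normal}`** in the Kerr–Schild chart:
`K(v, w) = g(Dn v, dL w) + ½ K(n; dL v, dL w)`, valid at every point of the slice.
O'Neill 1983, Ch. 4, Lemma 4.4; Wald 1984, (10.2.13). [cite: ONeill1983, Ch. 4, Lemma 4.4] -/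
theorem secondFundamentalForm_leaf_eq_chart [Kerr.Facts] [(Kerr.smoothMetric M a 0).HasLeviCivita]
    (hM : 0 ≤ M) (hρ₁ : rhoH M a ≤ ρ₁) (hb : rH M a < b) (x : slice 0 ρ₁) (v w : E3) :
    (Kerr.smoothMetric M a 0).secondFundamentalForm 𝓘(ℝ, E3) (leaf M a b ρ₁ hM hρ₁)
        (normal M a b ρ₁ hM hρ₁) x v w =
      Kerr.bilin M a (leafRep M a b x) (fderiv ℝ (normalRep M a b) x v) (fderiv ℝ (leafRep M a b) x w) +
        2⁻¹ * OpensChart.koszulForm (Kerr.bilin M a) (leafRep M a b x) (normalRep M a b x)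
          (fderiv ℝ (leafRep M a b) x v) (fderiv ℝ (leafRep M a b) x w) := by
  have hρ : rhoH M a < ‖(x : E3)‖ := rhoH_lt_norm hρ₁ x
  have hrad : 0 < radius a (leafRep M a b x) := by
    rw [radius_leafRep M a b (ne_zero_of_mem_slice_zero x) (qiRadius_pos_of_rhoH_lt hM hρ)]
    exact qiRadius_pos_of_rhoH_lt hM hρ
  have hGd : DifferentiableAt ℝ (Kerr.bilin M a) (leaf M a b ρ₁ hM hρ₁ x : E4) :=
    (contDiffAt_bilin M a hrad (n := ∞)).differentiableAt (by simp)
  rw [OpensChart.secondFundamentalForm_eq_of_repr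
    (g := (Kerr.smoothMetric M a 0).toPseudoRiemannianMetric) (G := Kerr.bilin M a)
    (Kerr.smoothMetric_val M a 0) (f := leaf M a b ρ₁ hM hρ₁) (Φ := leafRep M a b)
    (coe_leaf hM hρ₁) (ν := normal M a b ρ₁ hM hρ₁) (N := normalRep M a b) (normal_apply hM hρ₁)
    ((contDiffAt_leafRep hb hρ).differentiableAt (by simp))
    ((contDiffAt_normalRep hM hb hρ).differentiableAt (by simp)) hGd v w]
  have hΓ := OpensChart.val_christoffel_const (g := (Kerr.smoothMetric M a 0).toPseudoRiemannianMetric)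
    (G := Kerr.bilin M a) (leaf M a b ρ₁ hM hρ₁ x) (normalRep M a b x) (fderiv ℝ (leafRep M a b) x v)
    (fderiv ℝ (leafRep M a b) x w)
  have hΓ' : Kerr.bilin M a (leafRep M a b x) (OpensChart.christoffel
      (Kerr.smoothMetric M a 0).toPseudoRiemannianMetric (Kerr.bilin M a) (leaf M a b ρ₁ hM hρ₁ x)
      (normalRep M a b x) (fderiv ℝ (leafRep M a b) x v)) (fderiv ℝ (leafRep M a b) x w) =
      2⁻¹ * OpensChart.koszulForm (Kerr.bilin M a) (leafRep M a b x) (normalRep M a b x)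
        (fderiv ℝ (leafRep M a b) x v) (fderiv ℝ (leafRep M a b) x w) := by
    rw [← coe_leaf hM hρ₁]
    exact hΓ
  show Kerr.bilin M a (leafRep M a b x) (fderiv ℝ (normalRep M a b) x v + OpensChart.christoffel
      (Kerr.smoothMetric M a 0).toPseudoRiemannianMetric (Kerr.bilin M a) (leaf M a b ρ₁ hM hρ₁ x)
      (normalRep M a b x) (fderiv ℝ (leafRep M a b) x v)) (fderiv ℝ (leafRep M a b) x w) = _
  rw [map_add, add_apply, hΓ']

/-- The chart expression of `K^g_{leaf, normal}(v, w)` is continuous in the base point on the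
slice. [cite: BrandtSeidel1996, §II] -/
theorem continuousAt_chartK (hM : 0 ≤ M) (hb : rH M a < b) {y : E3} (hy : rhoH M a < ‖y‖) (v w : E3) :
    ContinuousAt (fun y ↦
      Kerr.bilin M a (leafRep M a b y) (fderiv ℝ (normalRep M a b) y v) (fderiv ℝ (leafRep M a b) y w) +
        2⁻¹ * OpensChart.koszulForm (Kerr.bilin M a) (leafRep M a b y) (normalRep M a b y)
          (fderiv ℝ (leafRep M a b) y v) (fderiv ℝ (leafRep M a b) y w)) y := by
  have hy0 : y ≠ 0 := by
    intro h0; rw [h0, norm_zero] at hy; exact absurd hy (not_lt.2 (rhoH_nonneg M a))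
  have hsm := contDiffAt_leafRep (M := M) (a := a) hb hy
  have hL : ContinuousAt (leafRep M a b) y := hsm.continuousAt
  have hD : ContinuousAt (fun y ↦ fderiv ℝ (leafRep M a b) y) y :=
    (hsm.fderiv_right (m := 0) (by norm_num)).continuousAt
  have hN : ContinuousAt (normalRep M a b) y := (contDiffAt_normalRep hM hb hy).continuousAt
  have hDN : ContinuousAt (fun y ↦ fderiv ℝ (normalRep M a b) y) y :=
    ((contDiffAt_normalRep hM hb hy).fderiv_right (m := 0) (by norm_num)).continuousAt
  have hrad : 0 < radius a (leafRep M a b y) := by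
    rw [radius_leafRep M a b hy0 (qiRadius_pos_of_rhoH_lt hM hy)]
    exact qiRadius_pos_of_rhoH_lt hM hy
  have hB : ContinuousAt (fun y ↦ Kerr.bilin M a (leafRep M a b y)) y :=
    ((contDiffAt_bilin M a hrad (n := ∞)).continuousAt).comp hL
  have hDB : ContinuousAt (fun y ↦ fderiv ℝ (Kerr.bilin M a) (leafRep M a b y)) y :=
    (((contDiffAt_bilin M a hrad (n := ∞)).fderiv_right (m := 0) (by norm_num)).continuousAt).comp hL
  have hDv : ContinuousAt (fun y ↦ fderiv ℝ (leafRep M a b) y v) y := hD.clm_apply continuousAt_const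
  have hDw : ContinuousAt (fun y ↦ fderiv ℝ (leafRep M a b) y w) y := hD.clm_apply continuousAt_const
  have hDNv : ContinuousAt (fun y ↦ fderiv ℝ (normalRep M a b) y v) y := hDN.clm_apply continuousAt_const
  have h1 : ContinuousAt (fun y ↦ Kerr.bilin M a (leafRep M a b y) (fderiv ℝ (normalRep M a b) y v)
      (fderiv ℝ (leafRep M a b) y w)) y := (hB.clm_apply hDNv).clm_apply hDw
  have hK : ∀ {X Y Z : E3 → E4}, ContinuousAt X y → ContinuousAt Y y → ContinuousAt Z y →
      ContinuousAt (fun y ↦ fderiv ℝ (Kerr.bilin M a) (leafRep M a b y) (X y) (Y y) (Z y)) y :=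
    fun hX hY hZ ↦ ((hDB.clm_apply hX).clm_apply hY).clm_apply hZ
  simp only [OpensChart.koszulForm_apply]
  exact h1.add (continuousAt_const.mul (((hK hDv hN hDw).add (hK hN hDw hDv)).sub (hK hDw hDv hN)))

/-- **The second fundamental form of the Boyer–Lindquist leaf is the closed form `kRepCLM`** at
every point of the slice, axis included (`0 ≤ M`, `ρ₁ ≥ ρH`, `b > rH`): off the axis this is
`secondFundamentalForm_leaf_offAxis`; across the axis both sides are continuous
(`continuousAt_chartK`, `contDiffAt_kRepCLM`) and `Kerr.eqOn_slice_of_offAxis` applies.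
Brandt–Seidel 1995, (9); 1996, §II; Wald 1984, (10.2.13). [cite: BrandtSeidel1996, §II] -/
theorem secondFundamentalForm_leaf [Kerr.Facts] [(Kerr.smoothMetric M a 0).HasLeviCivita]
    (hM : 0 ≤ M) (hρ₁ : rhoH M a ≤ ρ₁) (hb : rH M a < b) (x : slice 0 ρ₁) (v w : E3) :
    (Kerr.smoothMetric M a 0).secondFundamentalForm 𝓘(ℝ, E3) (leaf M a b ρ₁ hM hρ₁)
      (normal M a b ρ₁ hM hρ₁) x v w = kRepCLM M a x v w := by
  set G : E3 → ℝ := fun y ↦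
    (Kerr.bilin M a (leafRep M a b y) (fderiv ℝ (normalRep M a b) y v) (fderiv ℝ (leafRep M a b) y w) +
      2⁻¹ * OpensChart.koszulForm (Kerr.bilin M a) (leafRep M a b y) (normalRep M a b y)
        (fderiv ℝ (leafRep M a b) y v) (fderiv ℝ (leafRep M a b) y w)) - kRepCLM M a y v w with hG
  have hcont : ContinuousOn G (slice 0 ρ₁) := by
    intro y hy
    have hyρ : rhoH M a < ‖y‖ := rhoH_lt_norm hρ₁ ⟨y, hy⟩
    have hk : ContinuousAt (fun y ↦ kRepCLM M a y v w) y :=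
      ((contDiffAt_kRepCLM hM hyρ).continuousAt.clm_apply continuousAt_const).clm_apply
        continuousAt_const
    exact ((continuousAt_chartK hM hb hyρ v w).sub hk).continuousWithinAt
  have hoff : ∀ y ∈ slice 0 ρ₁, (y 0 ≠ 0 ∨ y 1 ≠ 0) → G y = 0 := by
    intro y hy hax
    have h := secondFundamentalForm_leaf_offAxis hM hρ₁ hb ⟨y, hy⟩ hax v w
    rw [secondFundamentalForm_leaf_eq_chart hM hρ₁ hb ⟨y, hy⟩ v w] at h
    simp only [hG, sub_eq_zero]
    exact h
  have h := eqOn_slice_of_offAxis hcont hoff x x.2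
  simp only [hG, sub_eq_zero] at h
  rw [secondFundamentalForm_leaf_eq_chart hM hρ₁ hb x v w]
  exact h

end Kerr.BL

end Literature.Geometry.Lorentzian

end
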